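import Mathlib
import Summits.MatrixMultiplication.MatrixMultiplication.Theorems.FourierTwoFamiliesModPPrimeCyclicPowerGainThetaShapeCount

/-!
# Interval coverage by translated rectangle cliques (stub `stub_intervalCoverage`)

Crux `stmt-MatrixMultiplication-14310` (`FourierTwoFamiliesModP.PrimeLogDecay`), line
`fixed-delta-theta-certificate`; closes the registered milestone stub `stub_intervalCoverage` (pure additive
combinatorics in `ZMod p`, no kernels).

Setting: the interval frozen set `X₀ = {0, …, L − 1} ⊆ ZMod p` (as residues), `2 ≤ s`, `s² ≤ L`, `3L ≤ p`,
`b = ⌊s²/2⌋`, and the rectangle `P = [b, L)`, `Q = [0, b)` (as residues).  A block pair `(A, B)` is admissible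
when `|A| = |B| = s`, it is direct (clause (W)) and `A − B ⊆ X₀`.  The translated rectangle clique of `t : ZMod p`
consists of the block pairs with `A ∩ (t + P) ≠ ∅` and `B ∩ (t + Q) ≠ ∅`.  The stub: every admissible block
pair lies in at least `b` and at most `L + b` of them.

Proof.  Lower bound (`exists_middle_difference`, `image_subset_filter`): by clause (W) the difference set
`A − B` has `s²` elements (`ShapeCount.card_sub_of_direct`), all residues of `[0, L)`; the residues of
`[0, b) ∪ (L − b, L)` number at most `2b − 1 < s²`, so some `a − y = d` with `b ≤ d ≤ L − b`; then for every
`j < b` the translate `t_j = y − j` works (`y = t_j + j`, `a = t_j + (j + d)` with `b ≤ j + d < L`), and the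
`t_j` are distinct because `b < p`.  Upper bound (`filter_subset_arc`): if `B` meets `t + Q` then `t = y − j`
with `y ∈ B`, `j < b`; fixing `a ∈ A`, `a − y ∈ X₀` gives `y = a − i` with `i < L`, so `t = a − (i + j)` with
`i + j < L + b − 1`: the admissible translates lie in an arc of length `L + b − 1` ending at `a`.
-/

namespace Summit.MatrixMultiplication.MatrixMultiplication.Theorems.PrimeLogDecayTheta.IntervalCoverage

open scoped BigOperators Pointwise
open Summit.MatrixMultiplication.MatrixMultiplication.Theorems.PrimeCyclicPowerGainTheta

variable {p : ℕ} [Fact p.Prime]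

/-- Casting `ℕ → ZMod p` is injective below `p`. -/
theorem natCast_inj_of_lt {m n : ℕ} (hm : m < p) (hn : n < p) (h : (m : ZMod p) = n) : m = n := by
  rw [ZMod.natCast_eq_natCast_iff'] at h
  rwa [Nat.mod_eq_of_lt hm, Nat.mod_eq_of_lt hn] at h

/-- Upper bound: the translates `t` whose `Q`-window `t + [0, b)` meets `B` lie in the arc
`a − [0, L + b − 1)` for any `a ∈ A` (because `A − B ⊆ [0, L)`). -/
theorem filter_subset_arc (L b : ℕ) (A B P : Finset (ZMod p)) (a : ZMod p) (ha : a ∈ A)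
    (hX : A - B ⊆ (Finset.range L).image (Nat.cast : ℕ → ZMod p)) :
    (Finset.univ.filter fun t : ZMod p =>
        (A ∩ (t +ᵥ P)).Nonempty ∧
        (B ∩ (t +ᵥ (Finset.range b).image (Nat.cast : ℕ → ZMod p))).Nonempty)
      ⊆ (Finset.range (L + b - 1)).image (fun m : ℕ => a - (m : ZMod p)) := by
  intro t ht
  rw [Finset.mem_filter] at ht
  obtain ⟨y, hy⟩ := ht.2.2
  rw [Finset.mem_inter, Finset.mem_vadd_finset] at hy
  obtain ⟨hyB, q, hq, hqy⟩ := hy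
  rw [Finset.mem_image] at hq
  obtain ⟨j, hj, rfl⟩ := hq
  rw [Finset.mem_range] at hj
  have hi := hX (Finset.sub_mem_sub ha hyB)
  rw [Finset.mem_image] at hi
  obtain ⟨i, hi, hiy⟩ := hi
  rw [Finset.mem_range] at hi
  rw [Finset.mem_image]
  refine ⟨i + j, Finset.mem_range.2 (by omega), ?_⟩
  rw [vadd_eq_add] at hqy
  push_cast
  rw [hiy, ← hqy]
  ring

/-- Lower bound, step 1: an admissible block pair has a "middle" difference `a − y = d` with
`b ≤ d ≤ L − b` (`b = ⌊s²/2⌋`), because its `s²` distinct differences cannot all be among the `2b − 1`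
residues of `[0, b) ∪ (L − b, L)`. -/
theorem exists_middle_difference (s L : ℕ) (hs : 2 ≤ s) (hL : s ^ 2 ≤ L) (A B : Finset (ZMod p))
    (hA : A.card = s) (hB : B.card = s)
    (hW : ∀ a ∈ A, ∀ a' ∈ A, ∀ b ∈ B, ∀ b' ∈ B, (a - a') + (b - b') = 0 → a = a' ∧ b = b')
    (hX : A - B ⊆ (Finset.range L).image (Nat.cast : ℕ → ZMod p)) :
    ∃ a ∈ A, ∃ y ∈ B, ∃ d : ℕ, s ^ 2 / 2 ≤ d ∧ d + s ^ 2 / 2 ≤ L ∧ a - y = (d : ZMod p) := by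
  have h4 : 2 * 2 ≤ s ^ 2 := by rw [sq]; exact Nat.mul_le_mul hs hs
  have hcard : (A - B).card = s ^ 2 := by
    rw [ShapeCount.card_sub_of_direct (A, B) hW, hA, hB, sq]
  set Bad : Finset (ZMod p) :=
    (Finset.range (s ^ 2 / 2) ∪ Finset.Ioo (L - s ^ 2 / 2) L).image (Nat.cast : ℕ → ZMod p) with hBad
  have hBadcard : Bad.card < (A - B).card := by
    calc Bad.card ≤ (Finset.range (s ^ 2 / 2) ∪ Finset.Ioo (L - s ^ 2 / 2) L).card :=
          Finset.card_image_le
      _ ≤ (Finset.range (s ^ 2 / 2)).card + (Finset.Ioo (L - s ^ 2 / 2) L).card :=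
          Finset.card_union_le _ _
      _ < (A - B).card := by
          rw [Finset.card_range, Nat.card_Ioo, hcard]
          omega
  obtain ⟨x, hx, hxBad⟩ := Finset.exists_mem_notMem_of_card_lt_card hBadcard
  have hxX := hX hx
  rw [Finset.mem_image] at hxX
  obtain ⟨d, hd, rfl⟩ := hxX
  rw [Finset.mem_range] at hd
  have hd1 : s ^ 2 / 2 ≤ d ∧ d + s ^ 2 / 2 ≤ L := by
    by_contra hcon
    apply hxBad
    rw [hBad, Finset.mem_image]
    refine ⟨d, ?_, rfl⟩
    rw [Finset.mem_union, Finset.mem_range, Finset.mem_Ioo]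
    omega
  rw [Finset.mem_sub] at hx
  obtain ⟨a, ha, y, hy, hay⟩ := hx
  exact ⟨a, ha, y, hy, d, hd1.1, hd1.2, hay⟩

/-- Lower bound, step 2: if `a ∈ A`, `y ∈ B` and `a − y = d` with `b ≤ d ≤ L − b`, then every translate
`t_j = y − j`, `j < b`, has `y ∈ B ∩ (t_j + [0, b))` and `a ∈ A ∩ (t_j + [b, L))`. -/
theorem image_subset_filter (L b : ℕ) (A B : Finset (ZMod p)) (a y : ZMod p) (ha : a ∈ A) (hy : y ∈ B)
    (d : ℕ) (hbd : b ≤ d) (hdL : d + b ≤ L) (hay : a - y = (d : ZMod p)) :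
    (Finset.range b).image (fun j : ℕ => y - (j : ZMod p)) ⊆
      (Finset.univ.filter fun t : ZMod p =>
        (A ∩ (t +ᵥ (Finset.Ico b L).image (Nat.cast : ℕ → ZMod p))).Nonempty ∧
        (B ∩ (t +ᵥ (Finset.range b).image (Nat.cast : ℕ → ZMod p))).Nonempty) := by
  intro t ht
  rw [Finset.mem_image] at ht
  obtain ⟨j, hj, rfl⟩ := ht
  rw [Finset.mem_range] at hj
  rw [Finset.mem_filter]
  refine ⟨Finset.mem_univ _, ⟨a, ?_⟩, ⟨y, ?_⟩⟩
  · rw [Finset.mem_inter, Finset.mem_vadd_finset]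
    refine ⟨ha, ((j + d : ℕ) : ZMod p), ?_, ?_⟩
    · exact Finset.mem_image_of_mem _ (Finset.mem_Ico.2 ⟨by omega, by omega⟩)
    · rw [vadd_eq_add]
      push_cast
      linear_combination (-1 : ZMod p) * hay
  · rw [Finset.mem_inter, Finset.mem_vadd_finset]
    refine ⟨hy, (j : ZMod p), Finset.mem_image_of_mem _ (Finset.mem_range.2 hj), ?_⟩
    rw [vadd_eq_add, sub_add_cancel]

/-- **Registered milestone stub `stub_intervalCoverage`** (crux stmt-MatrixMultiplication-14310, line
fixed-delta-theta-certificate): for the interval `X₀ = {0, …, L − 1} ⊆ ZMod p` (as residues), `2 ≤ s`, `s² ≤ L`,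
`3L ≤ p`, and the rectangle `P = [b, L)`, `Q = [0, b)` with `b = ⌊s²/2⌋`, every admissible block pair `(A, B)`
(`|A| = |B| = s`, direct, `A − B ⊆ X₀`) lies in at least `b` and at most `L + b` of the translated rectangle
cliques: `b ≤ #{t : A ∩ (t + P) ≠ ∅ ∧ B ∩ (t + Q) ≠ ∅} ≤ L + b`. -/
theorem stub_intervalCoverage :
    ∀ (p : ℕ) [Fact p.Prime] (s L : ℕ), 2 ≤ s → s ^ 2 ≤ L → 3 * L ≤ p →
      ∀ (A B : Finset (ZMod p)), A.card = s → B.card = s →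
      (∀ a ∈ A, ∀ a' ∈ A, ∀ b ∈ B, ∀ b' ∈ B, (a - a') + (b - b') = 0 → a = a' ∧ b = b') →
      A - B ⊆ (Finset.range L).image (Nat.cast : ℕ → ZMod p) →
      s ^ 2 / 2 ≤ (Finset.univ.filter fun t : ZMod p =>
          (A ∩ (t +ᵥ (Finset.Ico (s ^ 2 / 2) L).image (Nat.cast : ℕ → ZMod p))).Nonempty ∧
          (B ∩ (t +ᵥ (Finset.range (s ^ 2 / 2)).image (Nat.cast : ℕ → ZMod p))).Nonempty).card ∧
      (Finset.univ.filter fun t : ZMod p =>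
          (A ∩ (t +ᵥ (Finset.Ico (s ^ 2 / 2) L).image (Nat.cast : ℕ → ZMod p))).Nonempty ∧
          (B ∩ (t +ᵥ (Finset.range (s ^ 2 / 2)).image (Nat.cast : ℕ → ZMod p))).Nonempty).card
        ≤ L + s ^ 2 / 2 := by
  intro p _ s L hs hsL hLp A B hA hB hW hX
  constructor
  · obtain ⟨a, ha, y, hy, d, hbd, hdL, hay⟩ := exists_middle_difference s L hs hsL A B hA hB hW hX
    calc s ^ 2 / 2 = ((Finset.range (s ^ 2 / 2)).image (fun j : ℕ => y - (j : ZMod p))).card := by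
          rw [Finset.card_image_of_injOn, Finset.card_range]
          intro j hj j' hj' h
          simp only [Finset.coe_range, Set.mem_Iio] at hj hj'
          exact natCast_inj_of_lt (by omega) (by omega) (sub_right_injective h)
      _ ≤ _ := Finset.card_le_card (image_subset_filter L (s ^ 2 / 2) A B a y ha hy d hbd hdL hay)
  · have hAne : A.Nonempty := by rw [← Finset.card_pos, hA]; omega
    obtain ⟨a, ha⟩ := hAne
    calc _ ≤ ((Finset.range (L + s ^ 2 / 2 - 1)).image (fun m : ℕ => a - (m : ZMod p))).card :=
          Finset.card_le_card (filter_subset_arc L (s ^ 2 / 2) A B _ a ha hX)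
      _ ≤ (Finset.range (L + s ^ 2 / 2 - 1)).card := Finset.card_image_le
      _ ≤ L + s ^ 2 / 2 := by rw [Finset.card_range]; omega

end Summit.MatrixMultiplication.MatrixMultiplication.Theorems.PrimeLogDecayTheta.IntervalCoverage
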